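import Literature.AnabelianGeometry.SemiGraphs.ThetaRayRefutationAnySchedule
import Literature.AnabelianGeometry.SemiGraphs.ThetaRayEscapeMaximalCompact
import Literature.AnabelianGeometry.SemiGraphs.TemperedGalFiniteSubgroupsBounded
import Literature.AnabelianGeometry.SemiGraphs.TemperedMaximalCompactFalseOfEscaping
import HarnessLib

/-!
# Typed-form sweep at `𝒢_θ`: which halves of the ∀-countable typings of [SemiAnbd] Thm 3.7 (iii)/(iv) hold
# and which fail at the countermodel — kernel witnesses (REFUTE-F1732 sequel; typed-form audit)

Mochizuki, *Semi-graphs of anabelioids*, Publ. RIMS **42** (2006), §3, Theorem 3.7 (iii)/(iv), manuscript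
pp. 40–41 [cite: MochizukiSemiAnbd2006, Thm 3.7(iv) p.41]; the printed proof concerns FINITE semi-graphs, where
both are kernel theorems of the cell (`compactInVerticialAt_of_finiteGraph`,
`maximalCompactIffVerticialAt_of_finiteGraph`, p431007).

PROOF-ONLY file (abc-iut cell, layer L3, row «TYPED-FORM-SWEEP@𝒢_θ» of abc-iut-L3-lead α106, seat
abc-iut-L3-d4 gen 4; label [typed-form audit, outside the [IUTchIII] Cor. 3.12 cone]; table
HOME/staging/L3/L3-d4/g4/TYPED-FORM-SWEEP-Gtheta.md; 0 definitions, no named fact).  The cell's ∀-countable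
typings `CompactInVerticial` (F-1732) and `MaximalCompactIffVerticial` (F-1750) are kernel-refuted at
`𝒢_θ(p, n) = thetaRayFreeProP p n` (`not_compactInVerticial` p442260, abc-iut-L3-d4 g3;
`not_maximalCompactIffVerticial` p443103, abc-iut-w6-d120).  Those are refutations of CONJUNCTIONS; this file
locates the failure and records what holds, at the canonical chart `π₁^temp(𝒢_θ)` of Prop. 3.6:

* (iii) clause 1 FAILS, explicitly: `thetaRayFreeProP_exists_compact_forall_not_le_verticial` — a compact
  subgroup lying in NO verticial subgroup (the escaping `C = closure⟨lim_k z_k⟩` of abc-iut-w6-d120's exported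
  escape `thetaRay_exists_compact_escaping_of_levelEscape`, fed by abc-iut-L3-t11's `thetaRay_levelEscape_data`
  and abc-iut-L3-d4's `thetaRay_hcrit_of_characters`, for EVERY schedule `n_k → ∞` via abc-iut-L3-t7's
  `FreeProPRankTwo.hcoin_concrete`);
* (iv) clause 1 «maximal compact ⇒ verticial» FAILS, explicitly:
  `thetaRayFreeProP_exists_isMaximalCompact_forall_not_mem_verticial` (Zorn above `C`, abc-iut-L3-t6's
  `exists_isMaximalCompactSubgroup_ge_temperedPiChart`, + abc-iut-L3-t5's `not_exists_verticial_of_le_of_escaping`);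
* the halves that HOLD at `𝒢_θ` — (iv) clause 1 «verticial ⇒ maximal compact» and clause 2 «edge-like ⇒
  intersection of two distinct maximal compacts», at EVERY locally finite Thm-3.7 graph — are the business of
  abc-iut-w6-d120's row HLOCFIN-DISCHARGE (`TemperedVerticialMaximalCompactOfLocallyFinite.lean`, discharging
  abc-iut-w6-d063's binder `hlocfin`) and of the sequel `ThetaRayTypedFormSweepPositive.lean`.

HONEST FRAMING as in the parent files: erratum-grade, about the ∀-countable TYPING only; the printed theorem
(finite `𝔾`) is a kernel theorem; nothing of the IUT corpus is touched; no side taken on [IUTchIII] Cor. 3.12.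
-/

noncomputable section

namespace Literature.AnabelianGeometry.SemiGraphs

open CategoryTheory Filter Topology Multiplicative
open ProfiniteSemiGraph ProfiniteSemiGraph.GaloisLevelData

/-! ### Generic ray of groups: the escaping compact and the exotic maximal compact, EXPORTED as witnesses -/

section Generic

variable {G E : Type} [Group G] [TopologicalSpace G] [IsTopologicalGroup G] [CompactSpace G]
  [TotallyDisconnectedSpace G] [Group E] [TopologicalSpace E] [IsTopologicalGroup E] [CompactSpace E]
  [TotallyDisconnectedSpace E] {up : E →ₜ* G} {low : ℕ → (E →ₜ* G)}
  {A V : ℕ → Type} [∀ n, CommGroup (A n)] [∀ n, TopologicalSpace (A n)] [∀ n, DiscreteTopology (A n)]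
  [∀ n, Finite (A n)] [∀ n, CommGroup (V n)]

/-- **A compact subgroup of `π₁^temp(𝒢_θ)` (canonical chart) lying in NO verticial subgroup**, from the level
data of the (iii) refutation (same binders as abc-iut-L3-d4's `thetaRay_not_compactInVerticialAt_of_characters`):
the escaping `C` of `thetaRay_exists_compact_escaping_of_levelEscape` fixes no compatible vertex system of the
canonical level trees, and every verticial subgroup fixes one ((I1) of `verticialLevelData_temperedPiChart`).
NEGATIVE-MODULO form. [cite: MochizukiSemiAnbd2006, Thm 3.7(iii) pp.40-41] -/
theorem thetaRay_exists_compact_forall_not_le_verticial_of_characters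
    (h37 : (thetaRay G E up low).Thm37Hypotheses)
    (P₀ : ((thetaRay G E up low).galoisLevelData h37.toProp36Hypotheses).PointSeq h37.isCountable (0 : ℕ))
    (e₀ : E) (hcoin : ∀ d : ℕ, ∃ N : ℕ, ∀ k, N ≤ k → (low (k + 1) e₀)⁻¹ * up e₀ ∈ charOpenCore G d)
    (χG : ∀ n, G →ₜ* A n) (hχA : ∀ (n k : ℕ) (t : E), χG n (low k t) = χG n (up t))
    (ab : ∀ n, G →* V n)
    (hK : ∀ n : ℕ, ∃ j₀ : ℕ, ∀ j, j₀ ≤ j → ∀ (w : ℕ)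
      (P : ((thetaRay G E up low).galoisLevelData h37.toProp36Hypotheses).PointSeq h37.isCountable w)
      (x : G), P.gal j x = 1 → ab n x = 1)
    (hsep : ∀ (n : ℕ) (t₁ t₂ : E), χG n (low (n + 1) t₁) = χG n (up e₀) → χG n (up t₂) = χG n (up e₀) →
      ab n (low (n + 1) t₁) ≠ ab n (up t₂)) :
    ∃ C : Subgroup ((thetaRay G E up low).temperedPiChart h37.toProp36Hypotheses).G,
      IsCompact (C : Set ((thetaRay G E up low).temperedPiChart h37.toProp36Hypotheses).G) ∧
      ∀ (v : ℕ) (H : Subgroup ((thetaRay G E up low).temperedPiChart h37.toProp36Hypotheses).G),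
        H ∈ verticialSubgroups ((thetaRay G E up low).temperedPiChart h37.toProp36Hypotheses) v → ¬ C ≤ H := by
  obtain ⟨hz, hfin, hfar⟩ := thetaRay_levelEscape_data h37.toProp36Hypotheses P₀ e₀ hcoin
  obtain ⟨C, hC, hesc⟩ := thetaRay_exists_compact_escaping_of_levelEscape h37 _ hz hfin hfar
    (thetaRay_hcrit_of_characters h37.toProp36Hypotheses P₀ e₀ χG hχA ab hK hsep)
  refine ⟨C, hC, fun v H hH hCH => ?_⟩
  exact (verticialLevelData_temperedPiChart (h36 := h37.toProp36Hypotheses)).not_exists_verticial_of_le_of_escaping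
    C C le_rfl hesc ⟨v, H, hH, hCH⟩

/-- **A MAXIMAL compact subgroup of `π₁^temp(𝒢_θ)` (canonical chart) which is NOT verticial** — indeed lies in
no verticial subgroup: Zorn above the escaping compact (abc-iut-L3-t6's binder-free
`exists_isMaximalCompactSubgroup_ge_temperedPiChart`).  NEGATIVE-MODULO form.
[cite: MochizukiSemiAnbd2006, Thm 3.7(iv) p.41] -/
theorem thetaRay_exists_isMaximalCompact_forall_not_mem_verticial_of_characters
    (h37 : (thetaRay G E up low).Thm37Hypotheses)
    (P₀ : ((thetaRay G E up low).galoisLevelData h37.toProp36Hypotheses).PointSeq h37.isCountable (0 : ℕ))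
    (e₀ : E) (hcoin : ∀ d : ℕ, ∃ N : ℕ, ∀ k, N ≤ k → (low (k + 1) e₀)⁻¹ * up e₀ ∈ charOpenCore G d)
    (χG : ∀ n, G →ₜ* A n) (hχA : ∀ (n k : ℕ) (t : E), χG n (low k t) = χG n (up t))
    (ab : ∀ n, G →* V n)
    (hK : ∀ n : ℕ, ∃ j₀ : ℕ, ∀ j, j₀ ≤ j → ∀ (w : ℕ)
      (P : ((thetaRay G E up low).galoisLevelData h37.toProp36Hypotheses).PointSeq h37.isCountable w)
      (x : G), P.gal j x = 1 → ab n x = 1)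
    (hsep : ∀ (n : ℕ) (t₁ t₂ : E), χG n (low (n + 1) t₁) = χG n (up e₀) → χG n (up t₂) = χG n (up e₀) →
      ab n (low (n + 1) t₁) ≠ ab n (up t₂)) :
    ∃ M : Subgroup ((thetaRay G E up low).temperedPiChart h37.toProp36Hypotheses).G,
      IsMaximalCompactSubgroup M ∧
      ∀ (v : ℕ) (H : Subgroup ((thetaRay G E up low).temperedPiChart h37.toProp36Hypotheses).G),
        H ∈ verticialSubgroups ((thetaRay G E up low).temperedPiChart h37.toProp36Hypotheses) v → ¬ M ≤ H := by
  obtain ⟨hz, hfin, hfar⟩ := thetaRay_levelEscape_data h37.toProp36Hypotheses P₀ e₀ hcoin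
  obtain ⟨C, hC, hesc⟩ := thetaRay_exists_compact_escaping_of_levelEscape h37 _ hz hfin hfar
    (thetaRay_hcrit_of_characters h37.toProp36Hypotheses P₀ e₀ χG hχA ab hK hsep)
  obtain ⟨M, hM, hCM⟩ :=
    (thetaRay G E up low).exists_isMaximalCompactSubgroup_ge_temperedPiChart h37.toProp36Hypotheses C hC
  refine ⟨M, hM, fun v H hH hMH => ?_⟩
  exact (verticialLevelData_temperedPiChart (h36 := h37.toProp36Hypotheses)).not_exists_verticial_of_le_of_escaping
    C M hCM hesc ⟨v, H, hH, hMH⟩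

end Generic

/-! ### The countermodel `𝒢_θ(p, n)` -/

namespace ProfiniteSemiGraph

open Literature.AnabelianGeometry.SemiGraphs.FreeProPRankTwo

variable (p : ℕ) [hp : Fact p.Prime] (n : ℕ → ℕ)

/-- `Thm37Hypotheses 𝒢_θ(p, n)`, unconditionally (the term of abc-iut-L3-d4's `thetaRayFreeProP_thm37Hypotheses'`,
re-assembled from the R3/R4/R5 constructors so that this file does not depend on that olean).
[cite: MochizukiSemiAnbd2006, Thm 3.7 p.40] -/
private theorem thm37θ : (thetaRayFreeProP p n).Thm37Hypotheses :=
  thetaRayFreeProP_thm37Hypotheses p n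
    (thetaRayFreeProP_isGaloisCountable p (α p) (α_ofAdd_one p) (fun m => θHom p m)
      (fun m => (θ p m).bijective) n)
    (thetaRayFreeProP_isQuasiCoherent p (α p) (α_ofAdd_one p) (fun m => θHom p m)
      (fun m => (θ p m).bijective) n)
    (thetaRayFreeProP_isTotallyElevated_concrete p n)
    (thetaRayFreeProP_isTotallyAloof_concrete p n)
    (thetaRayFreeProP_isTotallyEstranged_concrete p n)

/-- **(iii) clause 1 FAILS at `𝒢_θ(p, n)`, EXPLICITLY**: for every schedule `n_k → ∞`, a compact subgroup of the
canonical `π₁^temp(𝒢_θ)` lying in no verticial subgroup.  abc-iut-L3-d4's / abc-iut-L3-t7's instantiation block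
(ThetaRayRefutation / ThetaRayRefutationAnySchedule) feeding the exported escape.
[cite: MochizukiSemiAnbd2006, Thm 3.7(iii) pp.40-41] -/
theorem thetaRayFreeProP_exists_compact_forall_not_le_verticial (hn : Tendsto n atTop atTop)
    (h36 : (thetaRayFreeProP p n).Prop36Hypotheses) :
    ∃ C : Subgroup ((thetaRayFreeProP p n).temperedPiChart h36).G,
      IsCompact (C : Set ((thetaRayFreeProP p n).temperedPiChart h36).G) ∧
      ∀ (v : ℕ) (H : Subgroup ((thetaRayFreeProP p n).temperedPiChart h36).G),
        H ∈ verticialSubgroups ((thetaRayFreeProP p n).temperedPiChart h36) v → ¬ C ≤ H := by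
  classical
  haveI : NeZero p := ⟨hp.out.ne_zero⟩
  have h37 : (thetaRayFreeProP p n).Thm37Hypotheses := thm37θ p n
  -- a base point sequence over `v_0`
  obtain ⟨P₀⟩ := thetaRay_nonempty_pointSeq_zero (G := Grp p) (E := Multiplicative ℤ_[p]) (up := α p)
    (low := fun k => θα p (n k)) h36
  -- strict coherence (for abc-iut-L3-t6's level kernels)
  have hsc : (thetaRayFreeProP p n).IsStrictlyCoherent :=
    thetaRayFreeProP_isStrictlyCoherent p (α p) (α_ofAdd_one p) (fun m => θHom p m)
      (fun m => (θ p m).bijective) n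
  -- (hcoin) for every schedule tending to infinity (abc-iut-L3-t7, `ThetaRaySchedule.lean`)
  have hcoin : ∀ d : ℕ, ∃ N : ℕ, ∀ k, N ≤ k →
      ((fun k => θα p (n k)) (k + 1) (ofAdd (1 : ℤ_[p])))⁻¹ * α p (ofAdd 1) ∈ charOpenCore (Grp p) d :=
    FreeProPRankTwo.hcoin_concrete p n hn
  have hχA : ∀ (m k : ℕ) (t : Multiplicative ℤ_[p]),
      χaMod p (n (m + 1) + 1) ((fun k => θα p (n k)) k t) = χaMod p (n (m + 1) + 1) (α p t) := by
    intro m k t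
    change χaMod p _ (θ p (n k) (α p t)) = χaMod p _ (α p t)
    rw [χaMod_θ]
  have hK : ∀ m : ℕ, ∃ j₀ : ℕ, ∀ j, j₀ ≤ j → ∀ (w : ℕ)
      (P : ((thetaRayFreeProP p n).galoisLevelData h36).PointSeq h37.isCountable w) (x : Grp p),
      P.gal j x = 1 → (abMod p (n (m + 1) + 1)).toMonoidHom x = 1 := by
    intro m
    obtain ⟨j₀, hj₀⟩ := (thetaRayFreeProP p n).exists_level_hK h36 hsc (p ^ (2 * (n (m + 1) + 1)))
    exact ⟨j₀, fun j hj w P x hx =>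
      hj₀ j hj w P (abMod p (n (m + 1) + 1)).toMonoidHom (charOpenCore_le_ker_abMod p _) x hx⟩
  have hsep : ∀ (m : ℕ) (t₁ t₂ : Multiplicative ℤ_[p]),
      χaMod p (n (m + 1) + 1) ((fun k => θα p (n k)) (m + 1) t₁) = χaMod p (n (m + 1) + 1) (α p (ofAdd 1)) →
      χaMod p (n (m + 1) + 1) (α p t₂) = χaMod p (n (m + 1) + 1) (α p (ofAdd 1)) →
      (abMod p (n (m + 1) + 1)).toMonoidHom ((fun k => θα p (n k)) (m + 1) t₁) ≠
        (abMod p (n (m + 1) + 1)).toMonoidHom (α p t₂) := by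
    intro m t₁ t₂ h₁ h₂
    exact abMod_θ_α_ne_abMod_α_of_lt p (Nat.lt_succ_self _) t₁ t₂ h₁ h₂
  exact thetaRay_exists_compact_forall_not_le_verticial_of_characters (G := Grp p) (E := Multiplicative ℤ_[p])
    (up := α p) (low := fun k => θα p (n k))
    (A := fun m => Multiplicative (ZMod (p ^ (n (m + 1) + 1))))
    (V := fun m => Multiplicative (ZMod (p ^ (n (m + 1) + 1)) × ZMod (p ^ (n (m + 1) + 1))))
    h37 P₀ (ofAdd 1) hcoin (fun m => χaMod p (n (m + 1) + 1)) hχA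
    (fun m => (abMod p (n (m + 1) + 1)).toMonoidHom) hK hsep

/-- **(iv) clause 1 «maximal compact ⇒ verticial» FAILS at `𝒢_θ(p, n)`, EXPLICITLY**: for every schedule
`n_k → ∞`, a maximal compact subgroup of the canonical `π₁^temp(𝒢_θ)` which is not verticial (indeed lies in no
verticial subgroup). [cite: MochizukiSemiAnbd2006, Thm 3.7(iv) p.41] -/
theorem thetaRayFreeProP_exists_isMaximalCompact_forall_not_mem_verticial (hn : Tendsto n atTop atTop)
    (h36 : (thetaRayFreeProP p n).Prop36Hypotheses) :
    ∃ M : Subgroup ((thetaRayFreeProP p n).temperedPiChart h36).G, IsMaximalCompactSubgroup M ∧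
      ∀ v : ℕ, M ∉ verticialSubgroups ((thetaRayFreeProP p n).temperedPiChart h36) v := by
  obtain ⟨C, hC, hCv⟩ := thetaRayFreeProP_exists_compact_forall_not_le_verticial p n hn h36
  obtain ⟨M, hM, hCM⟩ := (thetaRayFreeProP p n).exists_isMaximalCompactSubgroup_ge_temperedPiChart h36 C hC
  exact ⟨M, hM, fun v hMv => hCv v M hMv hCM⟩

end ProfiniteSemiGraph

end Literature.AnabelianGeometry.SemiGraphs

end
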